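import Summits.AtomisticToContinuum.Crystallization.Theorems.FrustratedLawDichotomyNoTwistOfPairBound

/-!
# FrustratedLawDichotomy · crux `AperiodicFrustratedLawGap` (stmt-AtomisticToContinuum-27623) — TIGHTNESS OF THE SCALAR LINK BOUNDS: the
# pyritohedral twisted dozen at `t = 6/5` is an admissible fcc link (decomp-a2c, prover hand 2, gen 10)

The P-side certificate statements `LinkDiagonalBound (1/100) (6/5) fcc` and `LinkPairBound (1/100) (17/10) √3 fcc` (p823469, p823632) ask
that square diagonals stay `≥ 1.2` and `√3`-pairs stay `≥ 1.7` over all admissible links.  The twisted dozen of `FrustratedLawDichotomyTwistedDozen`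
(hand 2 gen 8; `(0,±5,±6), (±6,0,±5), (±5,±6,0)` at scale `√61`) IS an admissible link in exactly this sense — as the image of the fcc pattern
under the polynomial twist `(x₀, x₁, x₂) ↦ √(2/61)·(x₀(10x₁² + 12x₂²), x₁(12x₀² + 10x₂²), x₂(10x₀² + 12x₁²))` — and realises a square diagonal
of length `10/√61 ≈ 1.2804` and a `√3`-pair of length `√(182/61) ≈ 1.7273`.  So the certified constants cannot exceed these values: the
margins of the registered literals are `1.2 < 1.2804` (6 %) and `1.7 < 1.7273` (1.6 %).

* `scalarBounds_fcc_tight` : `(LinkPairBound (1/100) D₀ √2 fcc → D₀ ≤ √(100/61)) ∧ (LinkPairBound (1/100) D₀ √3 fcc → D₀ ≤ √(182/61))`.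
`[folklore]`; def-free (the twist is a local `fun`); no `sorry`.
-/

noncomputable section

namespace Summit.AtomisticToContinuum.Crystallization.Theorems.FrustratedLawDichotomyScalarBoundsTight

open Literature.Geometry.DiscreteGeometry
open Summit.AtomisticToContinuum.Crystallization.Theorems.FrustratedLawDichotomyTwoShellRigidityCut (E3)
open Summit.AtomisticToContinuum.Crystallization.Theorems.FrustratedLawDichotomyCappedRigidityCertPatterns
  (dist_scaledPattern dist_eq_one_iff_sqNormInt dist_eq_sqrt_two_iff_sqNormInt)
open Summit.AtomisticToContinuum.Crystallization.Theorems.FrustratedLawDichotomyCornerPairing (exists_int_of_mem_scaledPattern)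
open Summit.AtomisticToContinuum.Crystallization.Theorems.FrustratedLawDichotomyNoTwistCert (BondLike)
open Summit.AtomisticToContinuum.Crystallization.Theorems.FrustratedLawDichotomyNoTwistSwap (mem_scaledPattern_of_mem)
open Summit.AtomisticToContinuum.Crystallization.Theorems.FrustratedLawDichotomyNoTwistOfPairBound (LinkPairBound)

/-! ### §1 The integer twist and its table (by `decide`) -/

set_option maxRecDepth 8000 in
/-- All twelve twisted vectors have squared norm `61`. [folklore] -/
theorem twistInt_sqNorm : ∀ v ∈ fccInt,
    sqNormInt ![v 0 * (5 * v 1 ^ 2 + 6 * v 2 ^ 2), v 1 * (6 * v 0 ^ 2 + 5 * v 2 ^ 2), v 2 * (5 * v 0 ^ 2 + 6 * v 1 ^ 2)] = 61 := by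
  decide

set_option maxRecDepth 8000 in
/-- Distinct twisted vectors are at squared distance `≥ 62`. [folklore] -/
theorem twistInt_sep : ∀ v ∈ fccInt, ∀ w ∈ fccInt, v ≠ w →
    62 ≤ sqNormInt (![v 0 * (5 * v 1 ^ 2 + 6 * v 2 ^ 2), v 1 * (6 * v 0 ^ 2 + 5 * v 2 ^ 2), v 2 * (5 * v 0 ^ 2 + 6 * v 1 ^ 2)] -
      ![w 0 * (5 * w 1 ^ 2 + 6 * w 2 ^ 2), w 1 * (6 * w 0 ^ 2 + 5 * w 2 ^ 2), w 2 * (5 * w 0 ^ 2 + 6 * w 1 ^ 2)]) := by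
  decide

set_option maxRecDepth 8000 in
/-- Pattern contacts twist to squared distance exactly `62`. [folklore] -/
theorem twistInt_contact : ∀ v ∈ fccInt, ∀ w ∈ fccInt, sqNormInt (v - w) = ((2 : ℕ) : ℤ) →
    sqNormInt (![v 0 * (5 * v 1 ^ 2 + 6 * v 2 ^ 2), v 1 * (6 * v 0 ^ 2 + 5 * v 2 ^ 2), v 2 * (5 * v 0 ^ 2 + 6 * v 1 ^ 2)] -
      ![w 0 * (5 * w 1 ^ 2 + 6 * w 2 ^ 2), w 1 * (6 * w 0 ^ 2 + 5 * w 2 ^ 2), w 2 * (5 * w 0 ^ 2 + 6 * w 1 ^ 2)]) = 62 := by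
  decide

/-! ### §2 The real twist on the fcc pattern -/

/-- **The twist on pattern points**: for integer `v`, the polynomial twist of `v/√2` is `T(v)/√61`. [folklore] -/
theorem twist_intVec (v : Fin 3 → ℤ) :
    (((Real.sqrt 61)⁻¹ * Real.sqrt 2) •
        (WithLp.toLp 2 ![((Real.sqrt 2)⁻¹ • intVec v : E3) 0 * (10 * ((Real.sqrt 2)⁻¹ • intVec v : E3) 1 ^ 2 +
            12 * ((Real.sqrt 2)⁻¹ • intVec v : E3) 2 ^ 2),
          ((Real.sqrt 2)⁻¹ • intVec v : E3) 1 * (12 * ((Real.sqrt 2)⁻¹ • intVec v : E3) 0 ^ 2 +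
            10 * ((Real.sqrt 2)⁻¹ • intVec v : E3) 2 ^ 2),
          ((Real.sqrt 2)⁻¹ • intVec v : E3) 2 * (10 * ((Real.sqrt 2)⁻¹ • intVec v : E3) 0 ^ 2 +
            12 * ((Real.sqrt 2)⁻¹ • intVec v : E3) 1 ^ 2)] : E3)) =
      (Real.sqrt ((61 : ℕ) : ℝ))⁻¹ •
        intVec ![v 0 * (5 * v 1 ^ 2 + 6 * v 2 ^ 2), v 1 * (6 * v 0 ^ 2 + 5 * v 2 ^ 2), v 2 * (5 * v 0 ^ 2 + 6 * v 1 ^ 2)] := by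
  have h2 : Real.sqrt 2 ^ 2 = 2 := Real.sq_sqrt (by norm_num)
  have h2' : Real.sqrt 2 ≠ 0 := by positivity
  ext i
  fin_cases i <;> simp [intVec_apply] <;> field_simp <;> rw [h2] <;> ring

/-- Concrete integer values used below. [folklore] -/
theorem twistInt_witnesses :
    (![0, 1, 1] : Fin 3 → ℤ) ∈ fccInt ∧ (![0, -1, 1] : Fin 3 → ℤ) ∈ fccInt ∧ (![-1, 0, -1] : Fin 3 → ℤ) ∈ fccInt ∧
      sqNormInt ((![0, 1, 1] : Fin 3 → ℤ) - ![0, -1, 1]) = 2 * ((2 : ℕ) : ℤ) ∧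
      sqNormInt ((![0, 1, 1] : Fin 3 → ℤ) - ![-1, 0, -1]) = 3 * ((2 : ℕ) : ℤ) ∧
      sqNormInt ((![0 * (5 * 1 ^ 2 + 6 * 1 ^ 2), 1 * (6 * 0 ^ 2 + 5 * 1 ^ 2), 1 * (5 * 0 ^ 2 + 6 * 1 ^ 2)] : Fin 3 → ℤ) -
          ![0 * (5 * (-1) ^ 2 + 6 * 1 ^ 2), (-1) * (6 * 0 ^ 2 + 5 * 1 ^ 2), 1 * (5 * 0 ^ 2 + 6 * (-1) ^ 2)]) = 100 ∧
      sqNormInt ((![0 * (5 * 1 ^ 2 + 6 * 1 ^ 2), 1 * (6 * 0 ^ 2 + 5 * 1 ^ 2), 1 * (5 * 0 ^ 2 + 6 * 1 ^ 2)] : Fin 3 → ℤ) -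
          ![(-1) * (5 * 0 ^ 2 + 6 * (-1) ^ 2), 0 * (6 * (-1) ^ 2 + 5 * (-1) ^ 2), (-1) * (5 * (-1) ^ 2 + 6 * 0 ^ 2)]) = 182 := by
  refine ⟨by decide, by decide, by decide, by decide, by decide, by decide, by decide⟩

/-! ### §3 Tightness -/

/-- ★ **The scalar link bounds are nearly tight**: the twisted dozen is an admissible fcc link at tolerance `1/100` with a square diagonal
of length `√(100/61) ≈ 1.2804` and a `√3`-pair of length `√(182/61) ≈ 1.7273`; hence `LinkPairBound (1/100) D₀ √2 fcc → D₀ ≤ √(100/61)` and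
`LinkPairBound (1/100) D₀ √3 fcc → D₀ ≤ √(182/61)`. [folklore] -/
theorem scalarBounds_fcc_tight (D₀ : ℝ) :
    (LinkPairBound (1 / 100) D₀ (Real.sqrt 2) fccKissingPattern → D₀ ≤ Real.sqrt (100 / 61)) ∧
      (LinkPairBound (1 / 100) D₀ (Real.sqrt 3) fccKissingPattern → D₀ ≤ Real.sqrt (182 / 61)) := by
  classical
  set T : (Fin 3 → ℤ) → (Fin 3 → ℤ) := fun v =>
    ![v 0 * (5 * v 1 ^ 2 + 6 * v 2 ^ 2), v 1 * (6 * v 0 ^ 2 + 5 * v 2 ^ 2), v 2 * (5 * v 0 ^ 2 + 6 * v 1 ^ 2)] with hT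
  set F : E3 → E3 := fun x => ((Real.sqrt 61)⁻¹ * Real.sqrt 2) •
    (WithLp.toLp 2 ![x 0 * (10 * x 1 ^ 2 + 12 * x 2 ^ 2), x 1 * (12 * x 0 ^ 2 + 10 * x 2 ^ 2),
      x 2 * (10 * x 0 ^ 2 + 12 * x 1 ^ 2)] : E3) with hF
  set p : ↥fccKissingPattern → E3 := fun u => F (u : E3) with hp
  have h61 : (61 : ℕ) ≠ 0 := by norm_num
  -- integer representatives and the values of p
  have rep : ∀ u : ↥fccKissingPattern, ∃ v₀ ∈ fccInt, ((Real.sqrt 2)⁻¹ • intVec v₀ : E3) = u ∧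
      p u = (Real.sqrt ((61 : ℕ) : ℝ))⁻¹ • intVec (T v₀) := by
    intro u
    obtain ⟨v₀, hv₀, hv⟩ := exists_int_of_mem_scaledPattern u
    have hv' : ((Real.sqrt 2)⁻¹ • intVec v₀ : E3) = u := by simpa using hv
    refine ⟨v₀, hv₀, hv', ?_⟩
    simp only [hp, hF, hT]
    rw [← hv']
    exact twist_intVec v₀
  choose ι hι hιu hpι using rep
  have hιne : ∀ u v : ↥fccKissingPattern, u ≠ v → ι u ≠ ι v := by
    intro u v huv h
    apply huv
    apply Subtype.ext
    rw [← hιu u, ← hιu v, h]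
  -- norms, distances
  have hnorm : ∀ u, ‖p u‖ = 1 := by
    intro u
    rw [hpι u, norm_smul, norm_inv, Real.norm_of_nonneg (Real.sqrt_nonneg _), norm_intVec, twistInt_sqNorm _ (hι u)]
    push_cast
    rw [inv_mul_cancel₀]
    positivity
  have hdist : ∀ u v, dist (p u) (p v) = Real.sqrt ((sqNormInt (T (ι u) - T (ι v)) : ℝ) / 61) := by
    intro u v
    rw [hpι u, hpι v, dist_scaledPattern h61]
    push_cast
    rfl
  have hsep : ∀ u v, u ≠ v → 1 < dist (p u) (p v) := by
    intro u v huv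
    have h62 : (62 : ℝ) ≤ (sqNormInt (T (ι u) - T (ι v)) : ℝ) := by
      exact_mod_cast twistInt_sep _ (hι u) _ (hι v) (hιne u v huv)
    rw [hdist, show (1 : ℝ) = Real.sqrt 1 by simp]
    exact Real.sqrt_lt_sqrt (by norm_num) (by linarith)
  have hcontact : ∀ u v : ↥fccKissingPattern, dist (u : E3) (v : E3) = 1 → dist (p u) (p v) ≤ 1 + 1 / 100 := by
    intro u v huv
    have h2 : sqNormInt (ι u - ι v) = ((2 : ℕ) : ℤ) := by
      rw [← hιu u, ← hιu v] at huv
      have := (dist_eq_one_iff_sqNormInt two_ne_zero (ι u) (ι v)).1 (by simpa using huv)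
      exact this
    have h62 : (sqNormInt (T (ι u) - T (ι v)) : ℝ) = 62 := by
      exact_mod_cast twistInt_contact _ (hι u) _ (hι v) h2
    rw [hdist, h62, show (1 + 1 / 100 : ℝ) = Real.sqrt ((1 + 1 / 100) ^ 2) by rw [Real.sqrt_sq]; norm_num]
    exact Real.sqrt_le_sqrt (by norm_num)
  -- the hypotheses of `LinkPairBound`
  have hrad : ∀ u, 1 ≤ ‖p u‖ ∧ ‖p u‖ ≤ 1 + 1 / 100 := fun u => by rw [hnorm u]; norm_num
  have hinj : Function.Injective p := by
    intro u v h
    by_contra huv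
    have := hsep u v huv
    rw [h, dist_self] at this
    linarith
  have hK : ∀ Z ∈ insert (0 : E3) (Set.range p), Z = 0 ∨ ∃ w, Z = p w := by
    intro Z hZ
    rcases hZ with rfl | ⟨w, rfl⟩
    · exact Or.inl rfl
    · exact Or.inr ⟨w, rfl⟩
  have hfar : ∀ (u : ↥fccKissingPattern) (Z : E3), Z ∈ insert (0 : E3) (Set.range p) → Z ≠ p u → 1 ≤ ‖p u - Z‖ := by
    intro u Z hZ hne
    rcases hK Z hZ with rfl | ⟨w, rfl⟩
    · rw [sub_zero, hnorm]
    · have hwu : u ≠ w := fun h => hne (by rw [h])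
      rw [← dist_eq_norm]; exact (hsep u w hwu).le
  have hB0 : ∀ u, BondLike (1 / 100) (insert 0 (Set.range p)) 0 (p u) := by
    intro u
    refine ⟨fun Z hZ hne => ?_, fun Z hZ hne => ?_⟩
    · rcases hK Z hZ with rfl | ⟨w, rfl⟩
      · exact absurd rfl hne
      · rw [zero_sub, norm_neg, zero_sub, norm_neg, hnorm, hnorm]; norm_num
    · rw [zero_sub, norm_neg, hnorm]
      nlinarith [hfar u Z hZ hne]
  have hBc : ∀ u v : ↥fccKissingPattern, dist (u : E3) (v : E3) = 1 → BondLike (1 / 100) (insert 0 (Set.range p)) (p u) (p v) := by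
    intro u v huv
    have hle : ‖p u - p v‖ ≤ 1 + 1 / 100 := by rw [← dist_eq_norm]; exact hcontact u v huv
    refine ⟨fun Z hZ hne => ?_, fun Z hZ hne => ?_⟩
    · nlinarith [hfar u Z hZ hne]
    · nlinarith [hfar v Z hZ hne]
  have hS : ∀ u v : ↥fccKissingPattern, u ≠ v → dist (u : E3) (v : E3) ≠ 1 → min ‖p u‖ ‖p v‖ < ‖p u - p v‖ := by
    intro u v huv _
    rw [hnorm, hnorm, min_self, ← dist_eq_norm]
    exact hsep u v huv
  -- the witnesses
  obtain ⟨ma, mb, mc, hab2, hac3, h100, h182⟩ := twistInt_witnesses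
  let a : ↥fccKissingPattern := ⟨(Real.sqrt ((2 : ℕ) : ℝ))⁻¹ • intVec ![0, 1, 1], mem_scaledPattern_of_mem ma⟩
  let b : ↥fccKissingPattern := ⟨(Real.sqrt ((2 : ℕ) : ℝ))⁻¹ • intVec ![0, -1, 1], mem_scaledPattern_of_mem mb⟩
  let c : ↥fccKissingPattern := ⟨(Real.sqrt ((2 : ℕ) : ℝ))⁻¹ • intVec ![-1, 0, -1], mem_scaledPattern_of_mem mc⟩
  have hab : dist (a : E3) (b : E3) = Real.sqrt 2 := (dist_eq_sqrt_two_iff_sqNormInt two_ne_zero _ _).2 hab2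
  have hac : dist (a : E3) (c : E3) = Real.sqrt 3 :=
    FrustratedLawDichotomyNoTwistOfPairBound.dist_eq_sqrt_three_of_sqNormInt two_ne_zero hac3
  have hpa : p a = (Real.sqrt ((61 : ℕ) : ℝ))⁻¹ • intVec (T ![0, 1, 1]) := by
    simp only [hp, hF, hT]; exact twist_intVec _
  have hpb : p b = (Real.sqrt ((61 : ℕ) : ℝ))⁻¹ • intVec (T ![0, -1, 1]) := by
    simp only [hp, hF, hT]; exact twist_intVec _
  have hpc : p c = (Real.sqrt ((61 : ℕ) : ℝ))⁻¹ • intVec (T ![-1, 0, -1]) := by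
    simp only [hp, hF, hT]; exact twist_intVec _
  have h100' : sqNormInt (T ![0, 1, 1] - T ![0, -1, 1]) = 100 := by rw [hT]; exact h100
  have h182' : sqNormInt (T ![0, 1, 1] - T ![-1, 0, -1]) = 182 := by rw [hT]; exact h182
  have dab : ‖p a - p b‖ = Real.sqrt (100 / 61) := by
    rw [← dist_eq_norm, hpa, hpb, dist_scaledPattern h61, h100']
    push_cast; norm_num
  have dac : ‖p a - p c‖ = Real.sqrt (182 / 61) := by
    rw [← dist_eq_norm, hpa, hpc, dist_scaledPattern h61, h182']
    push_cast; norm_num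
  constructor
  · intro hB
    have := hB p hrad hinj hB0 hBc hS a b hab
    rwa [dab] at this
  · intro hB
    have := hB p hrad hinj hB0 hBc hS a c hac
    rwa [dac] at this

/-- **Numerically**: `√(100/61) < 1.2805` and `√(182/61) < 1.7274` — against the registered `6/5` and `17/10`. [folklore] -/
theorem tight_values : Real.sqrt (100 / 61) < 12805 / 10000 ∧ Real.sqrt (182 / 61) < 17274 / 10000 :=
  ⟨(Real.sqrt_lt' (by norm_num)).2 (by norm_num), (Real.sqrt_lt' (by norm_num)).2 (by norm_num)⟩

end Summit.AtomisticToContinuum.Crystallization.Theorems.FrustratedLawDichotomyScalarBoundsTight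

end
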